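import Literature.Analysis.FluidPDE.LinearisedNSFourierDefs
import Literature.Analysis.FluidPDE.CorrectorFourierSymmetry
import HarnessLib

/-!
# Fourier-side estimates for the linearised Navier–Stokes equation on `T^d`: symbols

Analysis/FluidPDE proof file, second of the files `LinearisedNSFourier*` (objects in
`LinearisedNSFourierDefs`) proving existence of smooth solutions of the linearised Navier–Stokes
system `∂ₜw + (u·∇)w + (w·∇)u + ∇q = νΔw`, `div w = 0` along a smooth divergence-free field on
`[0, T] × T^d` (Constantin–Foias 1988, Ch. 14, (14.3)). Elementary bookkeeping for the symbols on
the frequency lattice `ℤ^d` (sup norm, weights `(1 + ‖k‖)^{-K}` of `ScalarFourierFamily`), the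
linear twin of `CorrectorFourierEstimates`:

* **Leray algebra for an arbitrary family `G`**: `(P G)ₗ = Gₗ - kₗ (k·G)/|k|²`
  (`leray_apply_eq`), `∑ₗ kₗ (P G)ₗ = 0` (`sum_intCast_mul_leray_apply`: the projected field is
  divergence free on the Fourier side), the pressure identity `-(P G)ₗ + Gₗ + 2πikₗ q̂ = 0` with
  `q̂ = -(k·G)/(2πi|k|²)` (`leray_pressure_identity`, the Fourier form of `ℙ = 1 - ∇Δ⁻¹div`,
  Lemarié-Rieusset 2016, §6.1), and `P(0) = 1`; specialised to `G = linSym U c`;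
* **decay**: `linSym` loses one derivative with a constant *linear* in the field constants
  (`hasDecay_linSym`, from `ScalarFourier.hasDecay_transportSym`), the projector costs the factor
  `2#d` (`hasDecay_leray_apply`);
* **linearity** in the velocity coefficients (`linSym_sub`, `linProjSym_sub`, `linSym_zero`);
* **continuity** in a parameter (`continuous_linSym_param`, `continuous_linProjSym_param`);
* **the zero mode**: `linSym U c l 0 = 0` when `U` and `c` are Fourier-divergence free
  (`linSym_zero_freq`, from `CorrectorFourier.transportSym_zero_of_divFree`: the Fourier form of
  `∫ (u·∇)w = 0 = ∫ (w·∇)u` for `div u = div w = 0`).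

## References

* P. Constantin, C. Foias, *Navier–Stokes Equations*, Univ. Chicago Press 1988, Ch. 14, (14.3). [`ConstantinFoiasNSE1988`]
* P. G. Lemarié-Rieusset, *The Navier–Stokes problem in the 21st century*, CRC 2016, §6.1, §8.5.
-/

noncomputable section

open MeasureTheory Real Set Filter Topology UnitAddTorus

namespace Literature.Analysis.FluidPDE

namespace LinearisedNSFourier

open ScalarFourier
open CorrectorFourier (leraySym leraySym_apply norm_leraySym_le sq_apply_le_freqNormSq
  sum_intCast_mul_self_eq transportSym_sub_left transportSym_zero_of_divFree sum_dsym_mul_eq_zero)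
open FourierNS (HasDecay clamp)
open Literature.Analysis.FunctionSpaces.Torus (freqNormSq)

variable {d : Type*} [Fintype d] [DecidableEq d]

/-! ### The Leray projector applied to an arbitrary family -/

section Leray

/-- The projector entries in `ℂ`: `P(k)ₗₘ = δₗₘ - kₗkₘ/|k|²`. [folklore] -/
theorem leraySym_eq (l m : d) (k : d → ℤ) :
    leraySym l m k = (if l = m then 1 else 0) - (k l : ℂ) * (k m : ℂ) / (freqNormSq k : ℂ) := by
  rw [leraySym_apply]
  push_cast
  split_ifs <;> simp

/-- **The projector applied to a family**: `(P(k) G)ₗ = Gₗ - kₗ (∑ₘ kₘ Gₘ) / |k|²`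
(adapted from `CorrectorFourier.sum_intCast_mul_projSym`). [folklore] -/
theorem leray_apply_eq (G : d → ℂ) (l : d) (k : d → ℤ) :
    ∑ m, leraySym l m k * G m = G l - (k l : ℂ) * (∑ m, (k m : ℂ) * G m) / (freqNormSq k : ℂ) := by
  simp_rw [leraySym_eq, sub_mul, Finset.sum_sub_distrib]
  congr 1
  · simp
  · rw [Finset.mul_sum, Finset.sum_div]
    refine Finset.sum_congr rfl fun m _ => ?_
    ring

omit [DecidableEq d] in
/-- At `|k|² = 0` (in `ℂ`) every coordinate of `k` vanishes. [folklore] -/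
theorem intCast_apply_eq_zero_of_freqNormSq {k : d → ℤ} (h0 : (freqNormSq k : ℂ) = 0) (l : d) :
    (k l : ℂ) = 0 := by
  have hr : freqNormSq k = 0 := by exact_mod_cast h0
  have hl := sq_apply_le_freqNormSq k l
  rw [hr] at hl
  have : (k l : ℝ) = 0 := by nlinarith [sq_nonneg (k l : ℝ)]
  exact_mod_cast this

/-- **The projected family is divergence free on the Fourier side**: `∑ₗ kₗ (P(k) G)ₗ = 0` for
every `G` (at `k ≠ 0` because `∑ₗ kₗ Pₗₘ = kₘ - kₘ|k|²/|k|² = 0`, at `k = 0` trivially). [folklore] -/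
theorem sum_intCast_mul_leray_apply (G : d → ℂ) (k : d → ℤ) :
    ∑ l, (k l : ℂ) * ∑ m, leraySym l m k * G m = 0 := by
  set S : ℂ := ∑ m, (k m : ℂ) * G m with hS
  simp_rw [leray_apply_eq, mul_sub, Finset.sum_sub_distrib]
  rw [← hS]
  have h2 : ∑ l, (k l : ℂ) * ((k l : ℂ) * S / (freqNormSq k : ℂ)) =
      (freqNormSq k : ℂ) * S / (freqNormSq k : ℂ) := by
    rw [← sum_intCast_mul_self_eq, Finset.sum_mul, Finset.sum_div]
    refine Finset.sum_congr rfl fun l _ => ?_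
    ring
  rw [h2]
  rcases eq_or_ne (freqNormSq k : ℂ) 0 with h0 | h0
  · have hS0 : S = 0 := by
      rw [hS]
      exact Finset.sum_eq_zero fun m _ => by rw [intCast_apply_eq_zero_of_freqNormSq h0 m, zero_mul]
    rw [hS0]; simp
  · field_simp
    ring

/-- **The pressure identity** `-(P G)ₗ + Gₗ + 2πikₗ q̂ = 0` with `q̂ = -(∑ₘ kₘ Gₘ)/(2πi|k|²)`, at
every frequency (including `k = 0`, where `P = 1`, `2πikₗ = 0`, `q̂ = 0`): the Fourier form of
`ℙ = 1 - ∇Δ⁻¹div` (Lemarié-Rieusset 2016, §6.1; adapted from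
`CorrectorFourier.projSym_pressure_identity`). [folklore] -/
theorem leray_pressure_identity (G : d → ℂ) (l : d) (k : d → ℤ) :
    -(∑ m, leraySym l m k * G m) + G l +
      dsym l k * (-(∑ m, (k m : ℂ) * G m) / (2 * π * Complex.I * (freqNormSq k : ℂ))) = 0 := by
  set S : ℂ := ∑ m, (k m : ℂ) * G m with hS
  rw [leray_apply_eq, ← hS, dsym_apply]
  rcases eq_or_ne (freqNormSq k : ℂ) 0 with h0 | h0
  · rw [h0]; simp
  · have h2pi : (2 * π * Complex.I : ℂ) ≠ 0 := by
      simp [Real.pi_ne_zero, Complex.I_ne_zero]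
    field_simp
    ring

/-- **At the zero frequency the projector is the identity**: `(P(0) G)ₗ = Gₗ`. [folklore] -/
theorem leray_apply_zero_freq (G : d → ℂ) (l : d) : ∑ m, leraySym l m 0 * G m = G l := by
  rw [leray_apply_eq]
  simp

/-- `∑ₗ kₗ (P linSym)ₗ = 0`: the projected linearised symbol is Fourier-divergence free. [folklore] -/
theorem sum_intCast_mul_linProjSym (U c : d → (d → ℤ) → ℂ) (k : d → ℤ) :
    ∑ l, (k l : ℂ) * linProjSym U c l k = 0 := by
  simp_rw [linProjSym_apply]
  exact sum_intCast_mul_leray_apply (fun m => linSym U c m k) k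

/-- The pressure identity for the linearised symbol:
`-(P linSym)ₗ + linSymₗ + 2πikₗ · linPresCoef = 0`. [folklore] -/
theorem linProjSym_pressure_identity (U c : d → (d → ℤ) → ℂ) (l : d) (k : d → ℤ) :
    -linProjSym U c l k + linSym U c l k + dsym l k * linPresCoef U c k = 0 := by
  rw [linProjSym_apply, linPresCoef_apply]
  exact leray_pressure_identity (fun m => linSym U c m k) l k

end Leray

/-! ### Decay of the symbols -/

section Decay

variable {K : ℕ} {A₀ A X₀ X : ℝ} {U c : d → (d → ℤ) → ℂ}

omit [DecidableEq d] in
/-- **Decay of the linearised symbol.** If the velocity coefficients decay to orders `2#d + 1`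
(constant `X₀`) and `K + 1` (constant `X`) and the drift coefficients to the same orders
(constants `A₀`, `A`), then `linSym U c l` decays to order `K` with the constant
`Tᴷ(A,A₀;X,X₀) + Tᴷ(X,X₀;A,A₀)`, `Tᴷ(A,A₀;X,X₀) = #d 2ᴷ latMass (A·2πX₀ + A₀·2πX)` — linear in
`(X₀, X)` (one derivative is lost, `ScalarFourier.hasDecay_transportSym`). [folklore] -/
theorem hasDecay_linSym (hA : 0 ≤ A) (hX : 0 ≤ X)
    (hU₀ : ∀ j, HasDecay (latOrder d + 1) A₀ (U j)) (hU : ∀ j, HasDecay (K + 1) A (U j))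
    (hc₀ : ∀ j, HasDecay (latOrder d + 1) X₀ (c j)) (hc : ∀ j, HasDecay (K + 1) X (c j)) (l : d) :
    HasDecay K
      (Fintype.card d * (2 ^ K * latMass d * (A * (2 * π * X₀) + A₀ * (2 * π * X))) +
        Fintype.card d * (2 ^ K * latMass d * (X * (2 * π * A₀) + X₀ * (2 * π * A))))
      (linSym U c l) := by
  have h1 : HasDecay K (Fintype.card d * (2 ^ K * latMass d * (A * (2 * π * X₀) + A₀ * (2 * π * X))))
      (transportSym U (c l)) :=
    hasDecay_transportSym (fun j => (hU₀ j).of_le (by omega)) (fun j => (hU j).of_le (by omega)) hA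
      (hc₀ l) (hc l) hX
  have h2 : HasDecay K (Fintype.card d * (2 ^ K * latMass d * (X * (2 * π * A₀) + X₀ * (2 * π * A))))
      (transportSym c (U l)) :=
    hasDecay_transportSym (fun j => (hc₀ j).of_le (by omega)) (fun j => (hc j).of_le (by omega)) hX
      (hU₀ l) (hU l) hA
  intro k
  rw [linSym_apply]
  exact norm_add_le_of_le (h1 k) (h2 k) |>.trans (le_of_eq (by ring))

/-- **The projector costs the factor `2#d`**: if every `G m` decays to order `K` with constant
`C`, then `k ↦ (P(k) G(k))ₗ` decays to order `K` with constant `2#d·C` (the entries are bounded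
by `2`, `CorrectorFourier.norm_leraySym_le`). [folklore] -/
theorem hasDecay_leray_apply {G : d → (d → ℤ) → ℂ} {C : ℝ} (hC : ∀ m, HasDecay K C (G m)) (l : d) :
    HasDecay K (2 * Fintype.card d * C) (fun k => ∑ m, leraySym l m k * G m k) := by
  intro k
  calc ‖∑ m, leraySym l m k * G m k‖
      ≤ ∑ m, ‖leraySym l m k * G m k‖ := norm_sum_le _ _
    _ ≤ ∑ _m : d, 2 * (C * ((1 + ‖k‖) ^ K)⁻¹) := Finset.sum_le_sum fun m _ => by
        rw [norm_mul]
        exact mul_le_mul (norm_leraySym_le l m k) (hC m k) (norm_nonneg _) zero_le_two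
    _ = 2 * Fintype.card d * C * ((1 + ‖k‖) ^ K)⁻¹ := by
        rw [Finset.sum_const, Finset.card_univ, nsmul_eq_mul]; ring

/-- Decay of the projected linearised symbol from decay of `linSym`. [folklore] -/
theorem hasDecay_linProjSym {C : ℝ} (hC : ∀ m, HasDecay K C (linSym U c m)) (l : d) :
    HasDecay K (2 * Fintype.card d * C) (linProjSym U c l) :=
  hasDecay_leray_apply (G := fun m k => linSym U c m k) hC l

end Decay

/-! ### Linearity in the velocity coefficients -/

section Linear

variable {A₀ X₁ X₂ : ℝ} {U c c' : d → (d → ℤ) → ℂ}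

omit [DecidableEq d] in
/-- **The linearised symbol is linear in the velocity coefficients**: differences. [folklore] -/
theorem linSym_sub (hU : ∀ j, HasDecay (latOrder d + 1) A₀ (U j))
    (hc : ∀ j, HasDecay (latOrder d + 1) X₁ (c j)) (hc' : ∀ j, HasDecay (latOrder d + 1) X₂ (c' j))
    (l : d) (k : d → ℤ) :
    linSym U c l k - linSym U c' l k = linSym U (fun j m => c j m - c' j m) l k := by
  rw [linSym_apply, linSym_apply, linSym_apply]
  have h1 := transportSym_sub (U := U) (fun j => (hU j).of_le (by omega)) (hc l) (hc' l) k
  have h2 := transportSym_sub_left (c₀ := U l) (fun j => (hc j).of_le (by omega))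
    (fun j => (hc' j).of_le (by omega)) (hU l) k
  linear_combination h1 + h2

/-- Differences of projected symbols are projected differences. [folklore] -/
theorem linProjSym_sub (hU : ∀ j, HasDecay (latOrder d + 1) A₀ (U j))
    (hc : ∀ j, HasDecay (latOrder d + 1) X₁ (c j)) (hc' : ∀ j, HasDecay (latOrder d + 1) X₂ (c' j))
    (l : d) (k : d → ℤ) :
    linProjSym U c l k - linProjSym U c' l k = linProjSym U (fun j m => c j m - c' j m) l k := by
  rw [linProjSym_apply, linProjSym_apply, linProjSym_apply, ← Finset.sum_sub_distrib]
  refine Finset.sum_congr rfl fun m _ => ?_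
  rw [← mul_sub, linSym_sub hU hc hc' m k]

omit [DecidableEq d] in
/-- The linearised symbol of the zero field vanishes. [folklore] -/
@[simp]
theorem linSym_zero (U : d → (d → ℤ) → ℂ) (l : d) (k : d → ℤ) :
    linSym U (fun _ _ => 0) l k = 0 := by
  rw [linSym_apply, transportSym_zero, transportSym_apply]
  simp [lconv_zero_left]

/-- The projected symbol of the zero field vanishes. [folklore] -/
@[simp]
theorem linProjSym_zero (U : d → (d → ℤ) → ℂ) (l : d) (k : d → ℤ) :
    linProjSym U (fun _ _ => 0) l k = 0 := by
  simp [linProjSym_apply]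

end Linear

/-! ### Continuity in a parameter -/

section Continuity

variable {Y : Type*} [TopologicalSpace Y] {A X : ℝ}

omit [DecidableEq d] in
/-- Continuity in a parameter of the linearised symbol (continuous fields with uniform decay of
order `2#d + 1`). [folklore] -/
theorem continuous_linSym_param {U : Y → d → (d → ℤ) → ℂ} {c : Y → d → (d → ℤ) → ℂ}
    (hU : ∀ j m, Continuous fun y => U y j m) (hc : ∀ j m, Continuous fun y => c y j m)
    (hUd : ∀ y j, HasDecay (latOrder d + 1) A (U y j)) (hcd : ∀ y j, HasDecay (latOrder d + 1) X (c y j))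
    (l : d) (k : d → ℤ) : Continuous fun y => linSym (U y) (c y) l k := by
  simp only [linSym_apply]
  refine Continuous.add ?_ ?_
  · exact continuous_transportSym_param (U := fun y => U y) (c := fun y => c y l) hU (hc l)
      (fun y j => (hUd y j).of_le (by omega)) (fun y => hcd y l) k
  · exact continuous_transportSym_param (U := fun y => c y) (c := fun y => U y l) hc (hU l)
      (fun y j => (hcd y j).of_le (by omega)) (fun y => hUd y l) k

/-- Continuity in a parameter of the projected symbol. [folklore] -/
theorem continuous_linProjSym_param {U : Y → d → (d → ℤ) → ℂ} {c : Y → d → (d → ℤ) → ℂ}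
    (hU : ∀ j m, Continuous fun y => U y j m) (hc : ∀ j m, Continuous fun y => c y j m)
    (hUd : ∀ y j, HasDecay (latOrder d + 1) A (U y j)) (hcd : ∀ y j, HasDecay (latOrder d + 1) X (c y j))
    (l : d) (k : d → ℤ) : Continuous fun y => linProjSym (U y) (c y) l k := by
  simp only [linProjSym_apply]
  exact continuous_finsetSum _ fun m _ =>
    continuous_const.mul (continuous_linSym_param hU hc hUd hcd m k)

end Continuity

/-! ### The zero mode -/

section ZeroMode

variable {A X : ℝ} {U c : d → (d → ℤ) → ℂ}

omit [DecidableEq d] in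
/-- **The linearised symbol vanishes at the zero frequency** when the drift and the velocity
coefficients are both Fourier-divergence free (`CorrectorFourier.transportSym_zero_of_divFree`
twice: the Fourier form of `∫ (u·∇)wₗ = 0 = ∫ (w·∇)uₗ` for `div u = div w = 0`). [folklore] -/
theorem linSym_zero_freq (hU : ∀ j, HasDecay (latOrder d + 1) A (U j))
    (hc : ∀ j, HasDecay (latOrder d + 1) X (c j)) (hUdiv : ∀ m, ∑ j, (m j : ℂ) * U j m = 0)
    (hcdiv : ∀ m, ∑ j, (m j : ℂ) * c j m = 0) (l : d) : linSym U c l 0 = 0 := by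
  rw [linSym_apply,
    transportSym_zero_of_divFree (fun j => (hU j).of_le (Nat.le_succ _)) (hc l) (sum_dsym_mul_eq_zero hUdiv),
    transportSym_zero_of_divFree (fun j => (hc j).of_le (Nat.le_succ _)) (hU l) (sum_dsym_mul_eq_zero hcdiv),
    add_zero]

/-- The projected symbol vanishes at the zero frequency under the same hypotheses. [folklore] -/
theorem linProjSym_zero_freq (hU : ∀ j, HasDecay (latOrder d + 1) A (U j))
    (hc : ∀ j, HasDecay (latOrder d + 1) X (c j)) (hUdiv : ∀ m, ∑ j, (m j : ℂ) * U j m = 0)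
    (hcdiv : ∀ m, ∑ j, (m j : ℂ) * c j m = 0) (l : d) : linProjSym U c l 0 = 0 := by
  rw [linProjSym_apply]
  simp_rw [linSym_zero_freq hU hc hUdiv hcdiv, mul_zero, Finset.sum_const_zero]

end ZeroMode

end LinearisedNSFourier

end Literature.Analysis.FluidPDE

end
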